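import Summits.MatrixMultiplication.MatrixMultiplication.Theses.GelfandPairHosts
import Summits.MatrixMultiplication.MatrixMultiplication.Theorems.GelfandPairHostsGelfandHostingStubGelfandTrick
import Summits.MatrixMultiplication.MatrixMultiplication.Theorems.GelfandPairHostsGelfandHostingStubDesignOfSaturatedTriple

/-!
# BC3 skeleton of crux `GelfandHosting` (stmt-MatrixMultiplication-7381), line `birth`

Lead prover `prover-line-stmt-MatrixMultiplication-7381-0`, 2026-08-17 (owned copy of the registered
skeleton `Cruxes/GelfandHosting/Lines/birth.lean`, sha fd813fdd…; the three stub signatures are the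
ledger's registered ones VERBATIM).

Line: a module-TPP design `(φ, ψ, χ)` of size `(|S|,|T|,|U•x₀|)` in a multiplicity-free `G`-set `X` is
produced from a TPP triple `(S,T,U)` of `G` whose third leg is right-saturated by the stabiliser of a
base point (`U·G_{x₀} = U`); multiplicity-freeness is certified by Gelfand's trick (generously
transitive ⇒ commutative centraliser algebra).  Stubs:

* `stub_gelfandTrick` — generously transitive ⇒ any two `G`-invariant matrices on `X` commute
  (LANDED p146244, `Theorems.stub_gelfandTrick`);
* `stub_designOfSaturatedTriple` — saturated TPP triple ⇒ design of size `(|S|,|T|,|U•x₀|)`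
  (LANDED p146232, `Theorems.stub_designOfSaturatedTriple`);
* `stub_saturatedTripleHosts` — the bet: generously transitive hosts with saturated TPP triples of
  capacity `D ≤ (|S||T||U•x₀|)^{(2+ε)/3}` for every `ε > 0` (OPEN; stronger than the crux).

`GelfandHosting_of` assembles the crux from the three stubs (sorry-free given the stubs).
-/

set_option linter.dupNamespace false

namespace Summit.MatrixMultiplication.MatrixMultiplication.Cruxes.GelfandHosting.Birth

open Summit.MatrixMultiplication.MatrixMultiplication.Theses.GelfandPairHosts

/-- Registered stub 1 (Gelfand's trick): if `G ↷ X` is generously transitive (every pair of points is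
swapped by some group element) then any two `G`-invariant complex matrices on `X` commute. -/
theorem stub_gelfandTrick : ∀ (G : Type) [Group G] (X : Type) [Fintype X] [MulAction G X], (∀ x y : X, ∃ g : G, g • x = y ∧ g • y = x) → ∀ A B : Matrix X X ℂ, (∀ (g : G) (x y : X), A (g • x) (g • y) = A x y) → (∀ (g : G) (x y : X), B (g • x) (g • y) = B x y) → A * B = B * A :=
  -- LANDED (wave 1, p146244): `Theorems/GelfandPairHostsGelfandHostingStubGelfandTrick.lean`
  Summit.MatrixMultiplication.MatrixMultiplication.Theorems.stub_gelfandTrick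

/-- Registered stub 2: a TPP triple `(S,T,U)` of `G` (Cohn–Umans 2003 Def. 2.1 form) whose third leg
is right-saturated by the stabiliser of `x₀` yields a module-TPP design of size `(|S|,|T|,|U•x₀|)`. -/
theorem stub_designOfSaturatedTriple : ∀ (G : Type) [Group G] (X : Type) [DecidableEq X] [MulAction G X] (x₀ : X) (S T U : Finset G), (∀ s ∈ S, ∀ s' ∈ S, ∀ t ∈ T, ∀ t' ∈ T, ∀ u ∈ U, ∀ u' ∈ U, s * s'⁻¹ * (t * t'⁻¹) * (u * u'⁻¹) = 1 → s = s' ∧ t = t' ∧ u = u') → (∀ u ∈ U, ∀ h : G, h • x₀ = x₀ → u * h ∈ U) → ∃ (φ : Fin S.card × Fin T.card → G) (ψ : Fin T.card × Fin (U.image fun u => u • x₀).card → X) (χ : Fin S.card × Fin (U.image fun u => u • x₀).card → X), ∀ (i i' : Fin S.card) (j j' : Fin T.card) (k k' : Fin (U.image fun u => u • x₀).card), φ (i, j) • ψ (j', k) = χ (i', k') ↔ (i = i' ∧ j = j' ∧ k = k') :=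
  -- LANDED (wave 1, p146232): `Theorems/GelfandPairHostsGelfandHostingStubDesignOfSaturatedTriple.lean`
  Summit.MatrixMultiplication.MatrixMultiplication.Theorems.stub_designOfSaturatedTriple

/-- Registered stub 3 (the bet): for every `ε > 0` there is a finite generously transitive `G ↷ X`,
a base point `x₀` and a TPP triple `(S,T,U)` with `U·G_{x₀} = U`, `|S||T||U•x₀| ≥ 2` and host cost
`D(G,X) = dim span{P_g} ≤ (|S||T||U•x₀|)^{(2+ε)/3}`.  OPEN; stronger than the crux. -/
theorem stub_saturatedTripleHosts : ∀ ε : ℝ, 0 < ε → ∃ (G : Type) (_ : Group G) (_ : Fintype G) (X : Type) (_ : Fintype X) (_ : DecidableEq X) (_ : MulAction G X) (x₀ : X) (S T U : Finset G), (∀ x y : X, ∃ g : G, g • x = y ∧ g • y = x) ∧ (∀ s ∈ S, ∀ s' ∈ S, ∀ t ∈ T, ∀ t' ∈ T, ∀ u ∈ U, ∀ u' ∈ U, s * s'⁻¹ * (t * t'⁻¹) * (u * u'⁻¹) = 1 → s = s' ∧ t = t' ∧ u = u') ∧ (∀ u ∈ U, ∀ h : G, h • x₀ = x₀ → u * h ∈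 U) ∧ 2 ≤ S.card * T.card * (U.image fun u => u • x₀).card ∧ (Module.finrank ℂ (Submodule.span ℂ (Set.range fun g : G => Matrix.of fun y x : X => if g • x = y then (1 : ℂ) else 0)) : ℝ) ≤ ((S.card * T.card * (U.image fun u => u • x₀).card : ℕ) : ℝ) ^ ((2 + ε) / 3) := by
  sorry

/-- Assembly (BC3 shape): the crux `GelfandHosting` from the three stubs — from stub 3 at `ε` obtain
`(G, X, x₀, S, T, U)`; stub 2 gives the design of size `(|S|,|T|,|U•x₀|)`; stub 1 gives
multiplicity-freeness; pack the crux's `∃` with `a,b,c := |S|,|T|,|U•x₀|`. -/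
theorem GelfandHosting_of : GelfandHosting := by
  intro ε hε
  obtain ⟨G, iG, iFG, X, iFX, iDX, iMA, x₀, S, T, U, hgt, htpp, hsat, h2le, hD⟩ :=
    stub_saturatedTripleHosts ε hε
  obtain ⟨φ, ψ, χ, hdes⟩ := stub_designOfSaturatedTriple G X x₀ S T U htpp hsat
  exact ⟨G, iG, iFG, X, iFX, iDX, iMA, S.card, T.card, (U.image fun u => u • x₀).card, φ, ψ, χ,
    stub_gelfandTrick G X hgt, h2le, hdes, hD⟩

end Summit.MatrixMultiplication.MatrixMultiplication.Cruxes.GelfandHosting.Birth
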